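import Literature.NumberTheory.EllipticCurves.BDPAnticyclotomicPAdicLFunction
import Literature.NumberTheory.EllipticCurves.CuspFormLFunction
import Literature.NumberTheory.LFunctions.DedekindZetaProofs
import Literature.NumberTheory.GaloisRepresentations.HeckeCharacterProofs
import HarnessLib

/-!
# Absolute convergence of the Rankin–Selberg Euler product `L(f/K, φ, s) = ∏_v (…)⁻¹` for `re s > 2`

Topic `Literature/NumberTheory/EllipticCurves`; THEOREMS ONLY (no definition, no named fact, net
literature debt `0`). Companion of `BDPAnticyclotomicPAdicLFunction.lean`, where the tree DEFINES
`rankinSelbergEulerProductHecke f φ s := ∏' v, (rankinSelbergLocalFactorInvHecke f φ v s)⁻¹` over the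
finite places `v` of `K` (local factor `1 − (α_ℓ^k + β_ℓ^k) w N(v)⁻ˢ + (α_ℓβ_ℓ)^k w² N(v)⁻²ˢ`,
`N(v) = ℓ^k`, `w = φ(ϖ_v)` extended by zero; Nekovář 1995 (0.5)/§3.4, Castella 2018 Thm. 3.1) and
states in its docstring that the product is absolutely convergent in a right half-plane. Here that
convergence is PROVED for `re s > 2` and every Hecke character with `|φ(ϖ_v)| ≤ 1` (in particular
every finite-order `φ`), so that the `tprod` is a genuine limit:

* `hasProd_rankinSelbergEulerProductHecke` / `multipliable_rankinSelbergLocalFactorInvHecke_inv` —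
  `HasProd (v ↦ (rankinSelbergLocalFactorInvHecke f φ v s)⁻¹) (rankinSelbergEulerProductHecke f φ s)`.

Proof (Neukirch, *Algebraic Number Theory* VII (5.2)/(8.1): an Euler product `∏ (1 − x_v)⁻¹` with
`∑ ‖x_v‖ < ∞` converges absolutely): `N(v) = ℓ^k` with `ℓ` prime and `1 ≤ k ≤ [K:ℚ]`
(`absNorm_heightOneSpectrum_eq_pow`), Hecke's bound `a_n(f) = O(n)` in weight `2`
(`exists_norm_cuspCoeff_le_mul`, from Mathlib's `CuspFormClass.qExpansion_isBigO`), the elementary bound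
`|α^k + β^k| ≤ 2(|a| + |e| + 1)^k` for the Newton power sums (`norm_frobTracePow_le`), hence
`‖x_v‖ ≤ B · N(v)^{1 − re s}` with `B` independent of `v`, and `∑_v N(v)^{1 − re s} < ∞` for
`re s > 2` (`Literature.NumberTheory.LFunctions.summable_norm_absNorm_cpow`); then
`Literature.NumberTheory.GaloisRepresentations.multipliable_inv_one_sub_of_summable_norm`.

Written by the literature seat of the cell `bsd-addord` (FULL-BSD rank-`≤ 1` programme; HOME
`run/shared/lean/pub/bsd-addord/`, `lit/DISCHARGE-PLAN-hArt-ArtinFormalism.md` step (S2): the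
left-hand side of the Artin formalism `rankinSelbergEulerProductHecke_baseChangeDirichlet_eq` is this
Euler product, which has to be regrouped by rational primes — `HasProd.primesOver_regroup` needs the
`HasProd` proved here).

## References

* J. Nekovář, *On the p-adic height of Heegner cycles*, Math. Ann. 302 (1995), (0.5) p. 611 and §3.4
  (the Euler product `L(f ⊗ K, 𝒲, s)`). [Nekovar1995]
* F. Castella, *On the p-adic variation of Heegner points* / Thm. 3.1 normalisation of `L(f/K, φ, s)`.
  [Castella2018]
* J. Neukirch, *Algebraic Number Theory* (1999), Ch. VII (5.2) Proposition and (8.1) (absolute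
  convergence of Euler products over the primes of a number field). [NeukirchANT1999]
* F. Diamond, J. Shurman, *A First Course in Modular Forms* (2005), Prop. 5.9.1 (Hecke's bound
  `a_n = O(n^{k/2})`). [DiamondShurman2005]
-/

noncomputable section

open scoped MatrixGroups ModularForm Topology
open CongruenceSubgroup NumberField IsDedekindDomain Complex Filter Asymptotics
open Literature.NumberTheory.GaloisRepresentations
open Literature.NumberTheory.EllipticCurves.ModularForms

namespace Literature.NumberTheory.EllipticCurves

universe u

variable {K : Type u} [Field K] [NumberField K] {N : ℕ}

/-! ### Elementary bounds -/

/-- **Newton power sums are at most exponential in `|a| + |e| + 1`**: for the sequence `t₀ = 2`,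
`t₁ = a`, `t_{k+2} = a t_{k+1} − e t_k` (`frobTracePow a e k = α^k + β^k` when `α + β = a`, `αβ = e`),
`|t_k| ≤ 2 (|a| + |e| + 1)^k`. [cite: NeukirchANT1999, Ch. VII §8 proof of (8.1) (bounding Euler factors)] -/
theorem norm_frobTracePow_le (a e : ℂ) : ∀ k : ℕ, ‖frobTracePow a e k‖ ≤ 2 * (‖a‖ + ‖e‖ + 1) ^ k
  | 0 => by simp [frobTracePow]
  | 1 => by
    rw [frobTracePow_one, pow_one]
    nlinarith [norm_nonneg a, norm_nonneg e]
  | k + 2 => by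
    have hM : 1 ≤ ‖a‖ + ‖e‖ + 1 := by nlinarith [norm_nonneg a, norm_nonneg e]
    have h1 := norm_frobTracePow_le a e (k + 1)
    have h0 := norm_frobTracePow_le a e k
    have hpow : (‖a‖ + ‖e‖ + 1) ^ k ≤ (‖a‖ + ‖e‖ + 1) ^ (k + 1) :=
      pow_le_pow_right₀ hM (Nat.le_succ k)
    rw [frobTracePow]
    have h0' : ‖frobTracePow a e k‖ ≤ 2 * (‖a‖ + ‖e‖ + 1) ^ (k + 1) :=
      h0.trans (by linarith [mul_le_mul_of_nonneg_left hpow (show (0:ℝ) ≤ 2 by norm_num)])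
    calc ‖a * frobTracePow a e (k + 1) - e * frobTracePow a e k‖
        ≤ ‖a‖ * ‖frobTracePow a e (k + 1)‖ + ‖e‖ * ‖frobTracePow a e k‖ := by
          refine (norm_sub_le _ _).trans ?_
          rw [norm_mul, norm_mul]
      _ ≤ ‖a‖ * (2 * (‖a‖ + ‖e‖ + 1) ^ (k + 1)) + ‖e‖ * (2 * (‖a‖ + ‖e‖ + 1) ^ (k + 1)) :=
          add_le_add (mul_le_mul_of_nonneg_left h1 (norm_nonneg a))
            (mul_le_mul_of_nonneg_left h0' (norm_nonneg e))
      _ = 2 * (‖a‖ + ‖e‖ + 1) ^ (k + 1) * (‖a‖ + ‖e‖) := by ring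
      _ ≤ 2 * (‖a‖ + ‖e‖ + 1) ^ (k + 1) * (‖a‖ + ‖e‖ + 1) :=
          mul_le_mul_of_nonneg_left (by linarith) (by positivity)
      _ = 2 * (‖a‖ + ‖e‖ + 1) ^ (k + 2) := by ring

/-- **Hecke's bound in weight `2`**: the coefficients of a cusp form `f ∈ S₂(Γ₀(N))` satisfy
`|a_n(f)| ≤ C n` for all `n ≥ 1`, for some constant `C > 0` (Diamond–Shurman Prop. 5.9.1,
`a_n = O(n^{k/2})`; Mathlib `CuspFormClass.qExpansion_isBigO`, made uniform in `n`).
[cite: DiamondShurman2005, Prop. 5.9.1] -/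
theorem exists_norm_cuspCoeff_le_mul [NeZero N] (f : CuspForm (Gamma0 N) 2) :
    ∃ C : ℝ, 0 < C ∧ ∀ n : ℕ, n ≠ 0 → ‖cuspCoeff f n‖ ≤ C * n := by
  have h := CuspFormClass.qExpansion_isBigO f
  rw [strictWidthInfty_Gamma0 N,
    show (fun n ↦ (UpperHalfPlane.qExpansion 1 ⇑f).coeff n) = cuspCoeff f from rfl] at h
  obtain ⟨C, hC0, hC⟩ := bound_of_isBigO_nat_atTop h
  refine ⟨C, hC0, fun n hn ↦ ?_⟩
  have hg : ((n : ℝ) ^ (((2 : ℤ) : ℝ) / 2)) ≠ 0 := by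
    have : (0 : ℝ) < n := by exact_mod_cast Nat.pos_of_ne_zero hn
    positivity
  have := hC hg
  rwa [show (((2 : ℤ) : ℝ) / 2) = (1 : ℝ) by norm_num, Real.rpow_one, Real.norm_natCast] at this

/-- **The norm of a finite prime is a prime power of exponent at most the degree**: for a finite place
`v` of `K`, `N(v) = ℓ^k` with `ℓ = N(v).minFac` prime, `1 ≤ k ≤ [K : ℚ]` and `k = N(v).factorization ℓ`
(`N(v) = #(𝓞_K/𝔭_v)` is a power of the residue characteristic `ℓ ∈ 𝔭_v`, and divides
`N(ℓ𝓞_K) = ℓ^{[K:ℚ]}`). [cite: NeukirchANT1999, Ch. I §8 (8.2)–(8.3) (fundamental identity, f_i ≤ n)] -/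
theorem absNorm_heightOneSpectrum_eq_pow (v : HeightOneSpectrum (𝓞 K)) :
    ∃ k : ℕ, 0 < k ∧ k ≤ Module.finrank ℚ K ∧ (Ideal.absNorm v.asIdeal).minFac.Prime ∧
      Ideal.absNorm v.asIdeal = (Ideal.absNorm v.asIdeal).minFac ^ k ∧
      (Ideal.absNorm v.asIdeal).factorization (Ideal.absNorm v.asIdeal).minFac = k := by
  classical
  set P := v.asIdeal with hP
  haveI : P.IsPrime := v.isPrime
  have hP0 : P ≠ ⊥ := v.ne_bot
  haveI : P.IsMaximal := v.isPrime.isMaximal hP0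
  letI : Field (𝓞 K ⧸ P) := Ideal.Quotient.field P
  haveI : Finite (𝓞 K ⧸ P) := Ideal.finiteQuotientOfFreeOfNeBot P hP0
  letI : Fintype (𝓞 K ⧸ P) := Fintype.ofFinite _
  obtain ⟨q, _, n, hq, hcard⟩ := FiniteField.card' (𝓞 K ⧸ P)
  have hN : Ideal.absNorm P = q ^ (n : ℕ) := by
    rw [Ideal.absNorm_apply, Submodule.cardQuot_apply, Nat.card_eq_fintype_card, hcard]
  have hmin : (Ideal.absNorm P).minFac = q := by
    rw [hN, Nat.pow_minFac n.pos.ne', hq.minFac_eq]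
  -- `q ∈ P`, hence `P ∣ (q)` and `N(P) ∣ N((q)) = q^{[K:ℚ]}`
  have hqmem : ((q : ℕ) : 𝓞 K) ∈ P := by
    have h1 : ((Ideal.absNorm P : ℕ) : 𝓞 K) ∈ P := Ideal.absNorm_mem P
    rw [hN, Nat.cast_pow] at h1
    exact Ideal.IsPrime.mem_of_pow_mem inferInstance _ h1
  have hle : Ideal.span {((q : ℕ) : 𝓞 K)} ≤ P := (Ideal.span_singleton_le_iff_mem _).mpr hqmem
  have hdvd : Ideal.absNorm P ∣ q ^ Module.finrank ℚ K := by
    have h1 := Ideal.absNorm_dvd_absNorm_of_le hle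
    rw [Ideal.absNorm_span_singleton] at h1
    have h2 : (Algebra.norm ℤ ((q : ℕ) : 𝓞 K)) = (q : ℤ) ^ Module.finrank ℚ K := by
      rw [show ((q : ℕ) : 𝓞 K) = algebraMap ℤ (𝓞 K) (q : ℤ) by simp, Algebra.norm_algebraMap,
        ← RingOfIntegers.rank]
    rw [h2, Int.natAbs_pow, Int.natAbs_natCast] at h1
    exact h1
  have hnle : (n : ℕ) ≤ Module.finrank ℚ K := by
    rw [hN] at hdvd
    exact (Nat.pow_dvd_pow_iff_le_right hq.one_lt).mp hdvd
  refine ⟨n, n.pos, hnle, by rw [hmin]; exact hq, by rw [hmin]; exact hN, ?_⟩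
  rw [hmin, hN, hq.factorization_pow, Finsupp.single_eq_same]

/-! ### The local factors: `F_v = 1 − x_v` with `∑_v ‖x_v‖ < ∞` -/

/-- The deviation `x_v := t_v w N(v)⁻ˢ − e^k w² N(v)⁻²ˢ` of the local factor from `1`
(`rankinSelbergLocalFactorInvHecke f φ v s = 1 − x_v`); an unfolding lemma in the notation of the
definition (`q = N(v)`, `ℓ = q.minFac`, `k = q.factorization ℓ`, `e = ℓ 𝟙_{ℓ∤N}`, `w = φ(ϖ_v)` extended
by zero). [cite: Nekovar1995, (0.5) p. 611 and §3.4] -/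
theorem rankinSelbergLocalFactorInvHecke_eq_one_sub (f : CuspForm (Gamma0 N) 2) (φ : HeckeCharacter K)
    (v : HeightOneSpectrum (𝓞 K)) (s : ℂ) :
    rankinSelbergLocalFactorInvHecke f φ v s = 1 -
      (frobTracePow (cuspCoeff f (Ideal.absNorm v.asIdeal).minFac)
          (if (Ideal.absNorm v.asIdeal).minFac ∣ N then 0 else ((Ideal.absNorm v.asIdeal).minFac : ℂ))
          ((Ideal.absNorm v.asIdeal).factorization (Ideal.absNorm v.asIdeal).minFac) *
        heckeValueExtZero φ v * ((Ideal.absNorm v.asIdeal : ℕ) : ℂ) ^ (-s) -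
      (if (Ideal.absNorm v.asIdeal).minFac ∣ N then 0 else ((Ideal.absNorm v.asIdeal).minFac : ℂ)) ^
          ((Ideal.absNorm v.asIdeal).factorization (Ideal.absNorm v.asIdeal).minFac) *
        heckeValueExtZero φ v ^ 2 * ((Ideal.absNorm v.asIdeal : ℕ) : ℂ) ^ (-2 * s)) := by
  rw [rankinSelbergLocalFactorInvHecke]
  ring

/-- **Uniform bound on the deviation of the local factors**: for `f ∈ S₂(Γ₀(N))`, a Hecke character
`φ` with `|φ(ϖ_v)| ≤ 1` (extended by zero) and `re s ≥ 0` there is `B` (independent of `v`) with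
`‖1 − rankinSelbergLocalFactorInvHecke f φ v s‖ ≤ B · N(v)^{1 − re s}` for every finite place `v`
(Hecke's bound `|a_ℓ| ≤ Cℓ`, `|α^k + β^k| ≤ 2((C+2)ℓ)^k = 2(C+2)^k N(v)`, `k ≤ [K:ℚ]`).
[cite: NeukirchANT1999, Ch. VII §8 proof of (8.1)] -/
theorem exists_norm_one_sub_rankinSelbergLocalFactorInvHecke_le [NeZero N] (f : CuspForm (Gamma0 N) 2)
    (φ : HeckeCharacter K) (hφ : ∀ v : HeightOneSpectrum (𝓞 K), ‖heckeValueExtZero φ v‖ ≤ 1)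
    {s : ℂ} (hs : 0 ≤ s.re) :
    ∃ B : ℝ, 0 ≤ B ∧ ∀ v : HeightOneSpectrum (𝓞 K),
      ‖1 - rankinSelbergLocalFactorInvHecke f φ v s‖ ≤
        B * ‖((Ideal.absNorm v.asIdeal : ℕ) : ℂ) ^ (-(s - 1))‖ := by
  obtain ⟨C, hC0, hC⟩ := exists_norm_cuspCoeff_le_mul f
  set d := Module.finrank ℚ K with hd
  refine ⟨2 * (C + 2) ^ d + 1, by positivity, fun v ↦ ?_⟩
  obtain ⟨k, hk0, hkd, hℓ, hqk, hfac⟩ := absNorm_heightOneSpectrum_eq_pow v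
  rw [rankinSelbergLocalFactorInvHecke_eq_one_sub, sub_sub_cancel, hfac]
  set q : ℕ := Ideal.absNorm v.asIdeal with hqdef
  set ℓ : ℕ := q.minFac with hℓdef
  set w : ℂ := heckeValueExtZero φ v with hwdef
  set e : ℂ := (if ℓ ∣ N then 0 else (ℓ : ℂ)) with hedef
  have hq0 : 0 < q := by rw [hqk]; exact pow_pos hℓ.pos k
  have hq1 : (1 : ℝ) ≤ q := by exact_mod_cast hq0
  have hℓ1 : (1 : ℝ) ≤ ℓ := by exact_mod_cast hℓ.one_lt.le
  have hqR : (q : ℝ) = (ℓ : ℝ) ^ k := by exact_mod_cast hqk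
  -- norms of the powers of `N(v)`
  have hns : ‖((q : ℕ) : ℂ) ^ (-s)‖ = (q : ℝ) ^ (-s.re) := by
    rw [Complex.norm_natCast_cpow_of_pos hq0, Complex.neg_re]
  have hn2s : ‖((q : ℕ) : ℂ) ^ (-2 * s)‖ = (q : ℝ) ^ (-2 * s.re) := by
    rw [Complex.norm_natCast_cpow_of_pos hq0]
    congr 1
    simp
  have hns1 : ‖((q : ℕ) : ℂ) ^ (-(s - 1))‖ = (q : ℝ) ^ (1 - s.re) := by
    rw [Complex.norm_natCast_cpow_of_pos hq0]
    congr 1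
    simp
  have h2le : (q : ℝ) ^ (-2 * s.re) ≤ (q : ℝ) ^ (-s.re) :=
    Real.rpow_le_rpow_of_exponent_le hq1 (by linarith)
  -- the pieces
  have hw : ‖w‖ ≤ 1 := hφ v
  have hw2 : ‖w ^ 2‖ ≤ 1 := by rw [norm_pow]; exact pow_le_one₀ (norm_nonneg _) hw
  have he : ‖e‖ ≤ ℓ := by
    rw [hedef]
    split_ifs
    · rw [norm_zero]; positivity
    · rw [Complex.norm_natCast]
  have hek : ‖e ^ k‖ ≤ q := by
    rw [norm_pow, hqR]
    exact pow_le_pow_left₀ (norm_nonneg _) he k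
  have ha : ‖cuspCoeff f ℓ‖ ≤ C * ℓ := hC ℓ hℓ.ne_zero
  have hM : ‖cuspCoeff f ℓ‖ + ‖e‖ + 1 ≤ (C + 2) * ℓ := by nlinarith
  have ht : ‖frobTracePow (cuspCoeff f ℓ) e k‖ ≤ 2 * (C + 2) ^ d * q := by
    refine (norm_frobTracePow_le _ _ k).trans ?_
    have h1 : (‖cuspCoeff f ℓ‖ + ‖e‖ + 1) ^ k ≤ ((C + 2) * ℓ) ^ k :=
      pow_le_pow_left₀ (by positivity) hM k
    have h2 : ((C + 2) * (ℓ : ℝ)) ^ k = (C + 2) ^ k * q := by rw [mul_pow, hqR]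
    have h3 : (C + 2) ^ k ≤ (C + 2) ^ d := pow_le_pow_right₀ (by linarith) hkd
    have hqpos : (0 : ℝ) ≤ q := by positivity
    nlinarith [mul_le_mul_of_nonneg_right h3 hqpos]
  -- assemble
  have hX : ‖frobTracePow (cuspCoeff f ℓ) e k * w * ((q : ℕ) : ℂ) ^ (-s)‖ ≤
      2 * (C + 2) ^ d * q * (q : ℝ) ^ (-s.re) := by
    rw [norm_mul, norm_mul, hns]
    have := mul_le_mul ht hw (norm_nonneg _) (by positivity)
    rw [mul_one] at this
    exact mul_le_mul_of_nonneg_right this (by positivity)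
  have hY : ‖e ^ k * w ^ 2 * ((q : ℕ) : ℂ) ^ (-2 * s)‖ ≤ q * (q : ℝ) ^ (-s.re) := by
    rw [norm_mul, norm_mul, hn2s]
    have := mul_le_mul hek hw2 (norm_nonneg _) (by positivity)
    rw [mul_one] at this
    exact (mul_le_mul this h2le (by positivity) (by positivity))
  have hq1s : (q : ℝ) * (q : ℝ) ^ (-s.re) = (q : ℝ) ^ (1 - s.re) := by
    rw [sub_eq_add_neg, Real.rpow_add (by positivity), Real.rpow_one]
  calc ‖frobTracePow (cuspCoeff f ℓ) e k * w * ((q : ℕ) : ℂ) ^ (-s) -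
          e ^ k * w ^ 2 * ((q : ℕ) : ℂ) ^ (-2 * s)‖
      ≤ 2 * (C + 2) ^ d * q * (q : ℝ) ^ (-s.re) + q * (q : ℝ) ^ (-s.re) :=
        (norm_sub_le _ _).trans (add_le_add hX hY)
    _ = (2 * (C + 2) ^ d + 1) * (q : ℝ) ^ (1 - s.re) := by rw [← hq1s]; ring
    _ = (2 * (C + 2) ^ d + 1) * ‖((q : ℕ) : ℂ) ^ (-(s - 1))‖ := by rw [hns1]

/-- **`∑_v ‖1 − F_v‖ < ∞` for `re s > 2`** (`F_v` the inverse local factors of `L(f/K, φ, s)`,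
`|φ(ϖ_v)| ≤ 1`): by the uniform bound `‖1 − F_v‖ ≤ B N(v)^{1 − re s}` and the absolute convergence of
`∑_𝔞 N(𝔞)^{-(s−1)}` for `re (s − 1) > 1` (Neukirch VII (5.2)).
[cite: NeukirchANT1999, Ch. VII §5 (5.2) Proposition and §8 (8.1)] -/
theorem summable_norm_one_sub_rankinSelbergLocalFactorInvHecke [NeZero N] (f : CuspForm (Gamma0 N) 2)
    (φ : HeckeCharacter K) (hφ : ∀ v : HeightOneSpectrum (𝓞 K), ‖heckeValueExtZero φ v‖ ≤ 1)
    {s : ℂ} (hs : 2 < s.re) :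
    Summable fun v : HeightOneSpectrum (𝓞 K) ↦ ‖1 - rankinSelbergLocalFactorInvHecke f φ v s‖ := by
  obtain ⟨B, hB0, hB⟩ := exists_norm_one_sub_rankinSelbergLocalFactorInvHecke_le f φ hφ
    (show 0 ≤ s.re by linarith)
  have hs1 : 1 < (s - 1).re := by simp; linarith
  have h1 : Summable fun I : Ideal (𝓞 K) ↦ ‖((Ideal.absNorm I : ℕ) : ℂ) ^ (-(s - 1))‖ :=
    Literature.NumberTheory.LFunctions.summable_norm_absNorm_cpow (K := K) hs1
  have h2 : Summable fun v : HeightOneSpectrum (𝓞 K) ↦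
      B * ‖((Ideal.absNorm v.asIdeal : ℕ) : ℂ) ^ (-(s - 1))‖ :=
    (h1.comp_injective (fun v w h ↦ HeightOneSpectrum.ext h)).mul_left B
  exact Summable.of_nonneg_of_le (fun v ↦ norm_nonneg _) hB h2

/-! ### The Euler product converges -/

/-- **The Rankin–Selberg Euler product is multipliable for `re s > 2`**: for `f ∈ S₂(Γ₀(N))` and a
Hecke character `φ` of `K` with `|φ(ϖ_v)| ≤ 1` (extended by zero), the family
`v ↦ (rankinSelbergLocalFactorInvHecke f φ v s)⁻¹` is multipliable (unconditionally convergent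
product over the finite places of `K`). [cite: Nekovar1995, (0.5) p. 611 and §3.4]
[cite: NeukirchANT1999, Ch. VII §8 (8.1)] -/
theorem multipliable_rankinSelbergLocalFactorInvHecke_inv [NeZero N] (f : CuspForm (Gamma0 N) 2)
    (φ : HeckeCharacter K) (hφ : ∀ v : HeightOneSpectrum (𝓞 K), ‖heckeValueExtZero φ v‖ ≤ 1)
    {s : ℂ} (hs : 2 < s.re) :
    Multipliable fun v : HeightOneSpectrum (𝓞 K) ↦ (rankinSelbergLocalFactorInvHecke f φ v s)⁻¹ := by
  have h := Literature.NumberTheory.GaloisRepresentations.multipliable_inv_one_sub_of_summable_norm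
    (summable_norm_one_sub_rankinSelbergLocalFactorInvHecke f φ hφ hs)
  refine h.congr fun v ↦ ?_
  rw [sub_sub_cancel]

/-- **`L(f/K, φ, s) = ∏_v (…)⁻¹` as a convergent product** (`HasProd` over the finite places of `K`)
for `re s > 2` and `|φ(ϖ_v)| ≤ 1`: the tree's `rankinSelbergEulerProductHecke f φ s` (defined as the
`tprod`) is the value of the unconditionally convergent Euler product. [cite: Nekovar1995, (0.5) p. 611 and §3.4]
[cite: Castella2018, Thm. 3.1] -/
theorem hasProd_rankinSelbergEulerProductHecke [NeZero N] (f : CuspForm (Gamma0 N) 2)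
    (φ : HeckeCharacter K) (hφ : ∀ v : HeightOneSpectrum (𝓞 K), ‖heckeValueExtZero φ v‖ ≤ 1)
    {s : ℂ} (hs : 2 < s.re) :
    HasProd (fun v : HeightOneSpectrum (𝓞 K) ↦ (rankinSelbergLocalFactorInvHecke f φ v s)⁻¹)
      (rankinSelbergEulerProductHecke f φ s) :=
  (multipliable_rankinSelbergLocalFactorInvHecke_inv f φ hφ hs).hasProd

/-- For a FINITE-ORDER Hecke character the hypothesis `|φ(ϖ_v)| ≤ 1` of the above holds at every finite
place (`|φ(ϖ_v)| = 1` at unramified `v`, value `0` at ramified `v` by the extension-by-zero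
convention). [cite: Nekovar1995, §3.4] -/
theorem norm_heckeValueExtZero_le_one_of_isFiniteOrder {φ : HeckeCharacter K} (hφ : φ.IsFiniteOrder)
    (v : HeightOneSpectrum (𝓞 K)) : ‖heckeValueExtZero φ v‖ ≤ 1 := by
  by_cases h : φ.IsUnramifiedAt v
  · rw [heckeValueExtZero_of_isUnramifiedAt h,
      HeckeCharacter.norm_valueAtUniformizer_of_isUnitary hφ.isUnitary v]
  · rw [heckeValueExtZero_of_not_isUnramifiedAt h, norm_zero]
    exact zero_le_one

/-- **`L(f/K, φ, s) = ∏_v (…)⁻¹` converges for every finite-order `φ` and `re s > 2`.**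
[cite: Nekovar1995, (0.5) p. 611 and §3.4] [cite: Castella2018, Thm. 3.1] -/
theorem hasProd_rankinSelbergEulerProductHecke_of_isFiniteOrder [NeZero N] (f : CuspForm (Gamma0 N) 2)
    {φ : HeckeCharacter K} (hφ : φ.IsFiniteOrder) {s : ℂ} (hs : 2 < s.re) :
    HasProd (fun v : HeightOneSpectrum (𝓞 K) ↦ (rankinSelbergLocalFactorInvHecke f φ v s)⁻¹)
      (rankinSelbergEulerProductHecke f φ s) :=
  hasProd_rankinSelbergEulerProductHecke f φ (norm_heckeValueExtZero_le_one_of_isFiniteOrder hφ) hs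

end Literature.NumberTheory.EllipticCurves

end
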